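import Summits.CriticalPhenomena.PercolationContinuityZ3.Theorems.PercNearOneGluingAdditiveGluingKnThm2RefinedAux
import Summits.CriticalPhenomena.PercolationContinuityZ3.Theorems.PercNearOneGluingAdditiveGluingBhkSets
import HarnessLib

/-! # Crux `PercNearOneGluing.AdditiveGluing` (stmt-CriticalPhenomena-4576) — a REFINED Kozma–Nitzan Theorem 2 exchange:
# the six BHK steps with the observer ADJOINED TO THE SOURCE SET (seat (d) exchange-certificate form, gen 2)

Support file (`--supports stmt-CriticalPhenomena-4576`); no definitions, no named facts, no sorries.

Kozma–Nitzan (arXiv:2401.12397, Theorem 2, pp. 8–9) write `X := μ(o↔A, o↔b) − μ(o↔A, a₃↔b) = I + II + III` and bound each of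
`I, II, III` by two van den Berg–Häggström–Kahn steps with the source sets `O = {a₁,a₂}, {a₁}, {a₂}` conditioned on
`N_O = {O ↮ A ∖ O}`.  On every event occurring in `I, II, III` the observer `o` is joined to `O`, hence NOT joined to `A ∖ O`;
so the same six steps can be run with the source set `O ∪ {o}` and the conditioning event
`N'_O = {O ∪ {o} ↮ A ∖ O} = N_O ∩ {o ↮ A ∖ O}` (BHK 2006 Thm. 1.3 for the cluster of the SET `O ∪ {o}`, Thm. 1.4 for the clusters
of `O ∪ {o}` and `A ∖ O`).  This gives (`knThm2_refined`)
  `P'₁ P'₂ P'₁₂ · X ≥ P'₁ P'₂ · A₁₂ (m'₁₂ − m'₃) + P'₂ P'₁₂ · A₁ (m'₁ − m'₂₃) + P'₁ P'₁₂ · A₂ (m''₂ − m''₁₃)`,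
`P'_O = μ(N'_O)`, `A_O = μ(N'_O ∩ {O ↔ o}) (= μ(N_O ∩ {O ↔ o}))`, `m'_T = μ(N'_O ∩ {b ↔ all of T})` — i.e. in conditional form
`X ≥ Σ_O φ'_O (m'_O − m'_{A∖O})` with the REFINED attachments `φ'_O = μ(o ↔ O | O ∪ {o} ↮ A ∖ O) = φ_O / (1 − φ_{A∖O}) ≥ φ_O`.
Each refined step is at least as strong as KN's (one more BHK correlation: `{b ↔ all of O}` resp. `{b ↔ all of A∖O}` is
positively resp. negatively correlated with `{o ↮ A∖O}` given `N_O`), no Lemma 2 and no minimality is used, and the certificate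
closes configurations where KN's bound `Σ_O φ_O (m_O − m_{A∖O})` is negative (hub configurations: `o` joined to the relays through a
common hub; exact engine of this seat, lab/refined.py: e.g. `X = .0059`, KN bound `−.0022`, refined bound `+.0042`).  The rational
weights `φ₂/(1−φ₁₃)` of the three-relay certificate charts (`chartF2_slack`) are exactly refined attachments.
Corollaries: the additive E-form (`knThm2_refined_eform`) and the designated-pocket-kernel block form (`dKernel_three_of_knThm2Refined`).
[cite: KozmaNitzan2024, Theorem 2 (§3.2, pp. 8–9); VandenbergHaggstromKahn2005, Thms. 1.3–1.4 (pp. 6–7)]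
-/

namespace Summit.CriticalPhenomena.PercolationContinuityZ3.Theorems

open MeasureTheory Set Literature.Probability.LatticeModels Literature.Probability.Percolation

noncomputable section
open Classical

variable {n : ℕ}

/-- **The refined Kozma–Nitzan Theorem-2 exchange at a designation** (`a₃` is any designated relay, no minimality; `o` is not a
relay).  With `N'₁₂ = {a₁↮a₃} ∩ {a₂↮a₃} ∩ {o↮a₃}`, `N'₁ = {a₁↮a₂} ∩ {a₁↮a₃} ∩ {o↮a₂} ∩ {o↮a₃}`, `N'₂` symmetric,
`P'_O = μ(N'_O)`, `A₁₂ = μ(N'₁₂ ∩ {A₁₂↔o})`, `A₁ = μ(N'₁ ∩ {a₁↔o})`, `A₂ = μ(N'₂ ∩ {a₂↔o})`, `m'_T = μ(N'_O ∩ {b ↔ all of T})`: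
if `P'₁ P'₂ · A₁₂ (m'₁₂ − m'₃) + P'₂ P'₁₂ · A₁ (m'₁ − m'₂₃) + P'₁ P'₁₂ · A₂ (m''₂ − m''₁₃) ≥ 0` then
`μ(o↔A, a₃↔b) ≤ μ(o↔A, o↔b)` (pre-FKG (3) at `a₃`).  Proof: `X = I + II + III` (`stub_knThm2GoodSplit`), the six BHK steps with
source sets `{a₁,a₂,o}`, `{a₁,o}`, `{a₂,o}` (`knRef_bhkOne/Two`), and `knRef_arith`.
[cite: KozmaNitzan2024, Theorem 2 (§3.2, pp. 8–9); VandenbergHaggstromKahn2005, Thms. 1.3–1.4] -/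
theorem knThm2_refined
    (hB1 : ∀ (n : ℕ) (w : Sym2 (Fin n) → unitInterval) (S : Finset (Fin n)) (X : Set (Fin n))
        (F G : Set (Sym2 (Fin n)) → ℝ), Monotone F → Monotone G → (∀ s ∈ S, s ∉ X) →
        (∫ ω in {ω : BondConfig (Fin n) | ∀ s ∈ S, ∀ x ∈ X, ¬ (openGraph ω).Reachable s x},
            F (⋃ s ∈ S, openEdgeCluster ω s) ∂(prodBernoulli w)) *
          (∫ ω in {ω : BondConfig (Fin n) | ∀ s ∈ S, ∀ x ∈ X, ¬ (openGraph ω).Reachable s x},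
            G (⋃ s ∈ S, openEdgeCluster ω s) ∂(prodBernoulli w)) ≤
        (prodBernoulli w).real
            {ω : BondConfig (Fin n) | ∀ s ∈ S, ∀ x ∈ X, ¬ (openGraph ω).Reachable s x} *
          ∫ ω in {ω : BondConfig (Fin n) | ∀ s ∈ S, ∀ x ∈ X, ¬ (openGraph ω).Reachable s x},
            F (⋃ s ∈ S, openEdgeCluster ω s) * G (⋃ s ∈ S, openEdgeCluster ω s)
              ∂(prodBernoulli w))
    (hB2 : ∀ (n : ℕ) (w : Sym2 (Fin n) → unitInterval) (S S' : Finset (Fin n))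
        (F G : Set (Sym2 (Fin n)) → ℝ), Monotone F → Monotone G → Disjoint S S' →
        (prodBernoulli w).real
            {ω : BondConfig (Fin n) | ∀ s ∈ S, ∀ x ∈ S', ¬ (openGraph ω).Reachable s x} *
          (∫ ω in {ω : BondConfig (Fin n) | ∀ s ∈ S, ∀ x ∈ S', ¬ (openGraph ω).Reachable s x},
            F (⋃ s ∈ S, openEdgeCluster ω s) * G (⋃ s ∈ S', openEdgeCluster ω s)
              ∂(prodBernoulli w)) ≤
        (∫ ω in {ω : BondConfig (Fin n) | ∀ s ∈ S, ∀ x ∈ S', ¬ (openGraph ω).Reachable s x},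
            F (⋃ s ∈ S, openEdgeCluster ω s) ∂(prodBernoulli w)) *
          (∫ ω in {ω : BondConfig (Fin n) | ∀ s ∈ S, ∀ x ∈ S', ¬ (openGraph ω).Reachable s x},
            G (⋃ s ∈ S', openEdgeCluster ω s) ∂(prodBernoulli w)))
    (w : Sym2 (Fin n) → unitInterval) (o b a₁ a₂ a₃ : Fin n)
    (h12 : a₁ ≠ a₂) (h13 : a₁ ≠ a₃) (h23 : a₂ ≠ a₃) (ho1 : o ≠ a₁) (ho2 : o ≠ a₂) (ho3 : o ≠ a₃)
    (hP₁₂ : 0 < (prodBernoulli w).real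
      ((openConn a₁ a₃)ᶜ ∩ (openConn a₂ a₃)ᶜ ∩ (openConn o a₃)ᶜ : Set (BondConfig (Fin n))))
    (hP₁ : 0 < (prodBernoulli w).real
      ((openConn a₁ a₂)ᶜ ∩ (openConn a₁ a₃)ᶜ ∩ ((openConn o a₂)ᶜ ∩ (openConn o a₃)ᶜ) : Set (BondConfig (Fin n))))
    (hP₂ : 0 < (prodBernoulli w).real
      ((openConn a₂ a₁)ᶜ ∩ (openConn a₂ a₃)ᶜ ∩ ((openConn o a₁)ᶜ ∩ (openConn o a₃)ᶜ) : Set (BondConfig (Fin n))))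
    (hcert : 0 ≤
        (prodBernoulli w).real ((openConn a₁ a₂)ᶜ ∩ (openConn a₁ a₃)ᶜ ∩ ((openConn o a₂)ᶜ ∩ (openConn o a₃)ᶜ) : Set (BondConfig (Fin n)))
          * (prodBernoulli w).real ((openConn a₂ a₁)ᶜ ∩ (openConn a₂ a₃)ᶜ ∩ ((openConn o a₁)ᶜ ∩ (openConn o a₃)ᶜ) : Set (BondConfig (Fin n)))
          * ((prodBernoulli w).real ((openConn a₁ a₃)ᶜ ∩ (openConn a₂ a₃)ᶜ ∩ (openConn o a₃)ᶜ ∩ (openConn a₁ o ∪ openConn a₂ o))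
            * ((prodBernoulli w).real ((openConn a₁ a₃)ᶜ ∩ (openConn a₂ a₃)ᶜ ∩ (openConn o a₃)ᶜ ∩ (openConn a₁ b ∩ openConn a₂ b))
              - (prodBernoulli w).real ((openConn a₁ a₃)ᶜ ∩ (openConn a₂ a₃)ᶜ ∩ (openConn o a₃)ᶜ ∩ openConn a₃ b)))
      + (prodBernoulli w).real ((openConn a₂ a₁)ᶜ ∩ (openConn a₂ a₃)ᶜ ∩ ((openConn o a₁)ᶜ ∩ (openConn o a₃)ᶜ) : Set (BondConfig (Fin n)))
          * (prodBernoulli w).real ((openConn a₁ a₃)ᶜ ∩ (openConn a₂ a₃)ᶜ ∩ (openConn o a₃)ᶜ : Set (BondConfig (Fin n)))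
          * ((prodBernoulli w).real ((openConn a₁ a₂)ᶜ ∩ (openConn a₁ a₃)ᶜ ∩ ((openConn o a₂)ᶜ ∩ (openConn o a₃)ᶜ) ∩ openConn a₁ o)
            * ((prodBernoulli w).real ((openConn a₁ a₂)ᶜ ∩ (openConn a₁ a₃)ᶜ ∩ ((openConn o a₂)ᶜ ∩ (openConn o a₃)ᶜ) ∩ openConn a₁ b)
              - (prodBernoulli w).real ((openConn a₁ a₂)ᶜ ∩ (openConn a₁ a₃)ᶜ ∩ ((openConn o a₂)ᶜ ∩ (openConn o a₃)ᶜ) ∩ (openConn a₂ b ∩ openConn a₃ b))))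
      + (prodBernoulli w).real ((openConn a₁ a₂)ᶜ ∩ (openConn a₁ a₃)ᶜ ∩ ((openConn o a₂)ᶜ ∩ (openConn o a₃)ᶜ) : Set (BondConfig (Fin n)))
          * (prodBernoulli w).real ((openConn a₁ a₃)ᶜ ∩ (openConn a₂ a₃)ᶜ ∩ (openConn o a₃)ᶜ : Set (BondConfig (Fin n)))
          * ((prodBernoulli w).real ((openConn a₂ a₁)ᶜ ∩ (openConn a₂ a₃)ᶜ ∩ ((openConn o a₁)ᶜ ∩ (openConn o a₃)ᶜ) ∩ openConn a₂ o)
            * ((prodBernoulli w).real ((openConn a₂ a₁)ᶜ ∩ (openConn a₂ a₃)ᶜ ∩ ((openConn o a₁)ᶜ ∩ (openConn o a₃)ᶜ) ∩ openConn a₂ b)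
              - (prodBernoulli w).real ((openConn a₂ a₁)ᶜ ∩ (openConn a₂ a₃)ᶜ ∩ ((openConn o a₁)ᶜ ∩ (openConn o a₃)ᶜ) ∩ (openConn a₁ b ∩ openConn a₃ b))))) :
    (prodBernoulli w).real ((openConn o a₁ ∪ openConn o a₂ ∪ openConn o a₃) ∩ openConn a₃ b) ≤
      (prodBernoulli w).real ((openConn o a₁ ∪ openConn o a₂ ∪ openConn o a₃) ∩ openConn o b) := by
  -- the six refined set-BHK bounds
  have hs12 : ({a₁, a₂} : Finset (Fin n)) ⊆ {a₁, a₂, o} := by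
    intro x hx; simp only [Finset.mem_insert, Finset.mem_singleton] at hx ⊢; tauto
  have hs1 : ({a₁} : Finset (Fin n)) ⊆ {a₁, o} := by
    intro x hx; simp only [Finset.mem_insert, Finset.mem_singleton] at hx ⊢; tauto
  have hs2 : ({a₂} : Finset (Fin n)) ⊆ {a₂, o} := by
    intro x hx; simp only [Finset.mem_insert, Finset.mem_singleton] at hx ⊢; tauto
  have i1 := knRef_bhkOne hB1 w {a₁, a₂, o} {a₁, a₂} hs12 ({a₃} : Set (Fin n)) o b
    (by simp [h13, h23, ho3])
  have i2 := knRef_bhkTwo hB2 w {a₁, a₂, o} {a₃} {a₁, a₂} {a₃} hs12 subset_rfl o b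
    (by simp [h13.symm, h23.symm, ho3.symm])
  have i3 := knRef_bhkOne hB1 w {a₁, o} {a₁} hs1 ({a₂, a₃} : Set (Fin n)) o b
    (by simp [h12, h13, ho2, ho3])
  have i4 := knRef_bhkTwo hB2 w {a₁, o} {a₂, a₃} {a₁} {a₂, a₃} hs1 subset_rfl o b
    (by simp [h12.symm, h13.symm, ho2.symm, ho3.symm])
  have i5 := knRef_bhkOne hB1 w {a₂, o} {a₂} hs2 ({a₁, a₃} : Set (Fin n)) o b
    (by simp [h12.symm, h23, ho1, ho3])
  have i6 := knRef_bhkTwo hB2 w {a₂, o} {a₁, a₃} {a₂} {a₁, a₃} hs2 subset_rfl o b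
    (by simp [h12, h23.symm, ho1.symm, ho3.symm])
  rw [knRef_sep3_set, Finset.set_biUnion_insert, Finset.set_biUnion_singleton,
    Finset.set_biInter_insert, Finset.set_biInter_singleton] at i1
  rw [knRef_sep3_finset, Finset.set_biUnion_insert, Finset.set_biUnion_singleton,
    Finset.set_biInter_singleton] at i2
  rw [knRef_sep2_set, Finset.set_biUnion_singleton, Finset.set_biInter_singleton] at i3
  rw [knRef_sep2_finset, Finset.set_biUnion_singleton, Finset.set_biInter_insert,
    Finset.set_biInter_singleton] at i4
  rw [knRef_sep2_set, Finset.set_biUnion_singleton, Finset.set_biInter_singleton] at i5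
  rw [knRef_sep2_finset, Finset.set_biUnion_singleton, Finset.set_biInter_insert,
    Finset.set_biInter_singleton] at i6
  -- `X = I + II + III`, rewritten on the refined conditioning events
  have hsplit := stub_knThm2GoodSplit n w o b a₁ a₂ a₃
  rw [knRef_absorb12 o a₁ a₂ a₃ (openConn a₁ b ∩ openConn a₂ b), knRef_absorb12 o a₁ a₂ a₃ (openConn a₃ b),
    knRef_absorb1 o a₁ a₂ a₃ (openConn a₁ b), knRef_absorb1 o a₁ a₂ a₃ (openConn a₂ b ∩ openConn a₃ b),
    knRef_absorb1 o a₂ a₁ a₃ (openConn a₂ b), knRef_absorb1 o a₂ a₁ a₃ (openConn a₁ b ∩ openConn a₃ b)] at hsplit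
  have key := knRef_arith hP₁₂ hP₁ hP₂ i1 i2 i3 i4 i5 i6 hcert
  linarith

/-- **Unconditional form of the refined exchange**: the set-BHK tools are the landed `stub_bhkSets`.
[cite: KozmaNitzan2024, Theorem 2 (§3.2, pp. 8–9); VandenbergHaggstromKahn2005, Thms. 1.3–1.4] -/
theorem knThm2_refined' (w : Sym2 (Fin n) → unitInterval) (o b a₁ a₂ a₃ : Fin n)
    (h12 : a₁ ≠ a₂) (h13 : a₁ ≠ a₃) (h23 : a₂ ≠ a₃) (ho1 : o ≠ a₁) (ho2 : o ≠ a₂) (ho3 : o ≠ a₃)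
    (hP₁₂ : 0 < (prodBernoulli w).real
      ((openConn a₁ a₃)ᶜ ∩ (openConn a₂ a₃)ᶜ ∩ (openConn o a₃)ᶜ : Set (BondConfig (Fin n))))
    (hP₁ : 0 < (prodBernoulli w).real
      ((openConn a₁ a₂)ᶜ ∩ (openConn a₁ a₃)ᶜ ∩ ((openConn o a₂)ᶜ ∩ (openConn o a₃)ᶜ) : Set (BondConfig (Fin n))))
    (hP₂ : 0 < (prodBernoulli w).real
      ((openConn a₂ a₁)ᶜ ∩ (openConn a₂ a₃)ᶜ ∩ ((openConn o a₁)ᶜ ∩ (openConn o a₃)ᶜ) : Set (BondConfig (Fin n))))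
    (hcert : 0 ≤
        (prodBernoulli w).real ((openConn a₁ a₂)ᶜ ∩ (openConn a₁ a₃)ᶜ ∩ ((openConn o a₂)ᶜ ∩ (openConn o a₃)ᶜ) : Set (BondConfig (Fin n)))
          * (prodBernoulli w).real ((openConn a₂ a₁)ᶜ ∩ (openConn a₂ a₃)ᶜ ∩ ((openConn o a₁)ᶜ ∩ (openConn o a₃)ᶜ) : Set (BondConfig (Fin n)))
          * ((prodBernoulli w).real ((openConn a₁ a₃)ᶜ ∩ (openConn a₂ a₃)ᶜ ∩ (openConn o a₃)ᶜ ∩ (openConn a₁ o ∪ openConn a₂ o))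
            * ((prodBernoulli w).real ((openConn a₁ a₃)ᶜ ∩ (openConn a₂ a₃)ᶜ ∩ (openConn o a₃)ᶜ ∩ (openConn a₁ b ∩ openConn a₂ b))
              - (prodBernoulli w).real ((openConn a₁ a₃)ᶜ ∩ (openConn a₂ a₃)ᶜ ∩ (openConn o a₃)ᶜ ∩ openConn a₃ b)))
      + (prodBernoulli w).real ((openConn a₂ a₁)ᶜ ∩ (openConn a₂ a₃)ᶜ ∩ ((openConn o a₁)ᶜ ∩ (openConn o a₃)ᶜ) : Set (BondConfig (Fin n)))
          * (prodBernoulli w).real ((openConn a₁ a₃)ᶜ ∩ (openConn a₂ a₃)ᶜ ∩ (openConn o a₃)ᶜ : Set (BondConfig (Fin n)))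
          * ((prodBernoulli w).real ((openConn a₁ a₂)ᶜ ∩ (openConn a₁ a₃)ᶜ ∩ ((openConn o a₂)ᶜ ∩ (openConn o a₃)ᶜ) ∩ openConn a₁ o)
            * ((prodBernoulli w).real ((openConn a₁ a₂)ᶜ ∩ (openConn a₁ a₃)ᶜ ∩ ((openConn o a₂)ᶜ ∩ (openConn o a₃)ᶜ) ∩ openConn a₁ b)
              - (prodBernoulli w).real ((openConn a₁ a₂)ᶜ ∩ (openConn a₁ a₃)ᶜ ∩ ((openConn o a₂)ᶜ ∩ (openConn o a₃)ᶜ) ∩ (openConn a₂ b ∩ openConn a₃ b))))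
      + (prodBernoulli w).real ((openConn a₁ a₂)ᶜ ∩ (openConn a₁ a₃)ᶜ ∩ ((openConn o a₂)ᶜ ∩ (openConn o a₃)ᶜ) : Set (BondConfig (Fin n)))
          * (prodBernoulli w).real ((openConn a₁ a₃)ᶜ ∩ (openConn a₂ a₃)ᶜ ∩ (openConn o a₃)ᶜ : Set (BondConfig (Fin n)))
          * ((prodBernoulli w).real ((openConn a₂ a₁)ᶜ ∩ (openConn a₂ a₃)ᶜ ∩ ((openConn o a₁)ᶜ ∩ (openConn o a₃)ᶜ) ∩ openConn a₂ o)
            * ((prodBernoulli w).real ((openConn a₂ a₁)ᶜ ∩ (openConn a₂ a₃)ᶜ ∩ ((openConn o a₁)ᶜ ∩ (openConn o a₃)ᶜ) ∩ openConn a₂ b)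
              - (prodBernoulli w).real ((openConn a₂ a₁)ᶜ ∩ (openConn a₂ a₃)ᶜ ∩ ((openConn o a₁)ᶜ ∩ (openConn o a₃)ᶜ) ∩ (openConn a₁ b ∩ openConn a₃ b))))) :
    (prodBernoulli w).real ((openConn o a₁ ∪ openConn o a₂ ∪ openConn o a₃) ∩ openConn a₃ b) ≤
      (prodBernoulli w).real ((openConn o a₁ ∪ openConn o a₂ ∪ openConn o a₃) ∩ openConn o b) :=
  knThm2_refined stub_bhkSets.1 stub_bhkSets.2 w o b a₁ a₂ a₃ h12 h13 h23 ho1 ho2 ho3 hP₁₂ hP₁ hP₂ hcert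


/-- **Additive E-form of the refined exchange** (what the tie line consumes): under the hypotheses of `knThm2_refined'` and
`μ(a₃ ↔ b) ≥ 1 − t`:  `μ({o ↔ A} ∖ {o ↔ b}) ≤ t`, since `μ(o↔A ∖ o↔b) = μ(o↔A) − μ(o↔A, o↔b) ≤ μ(o↔A) − μ(o↔A, a₃↔b) ≤ μ(a₃ ↮ b)`.
[cite: KozmaNitzan2024, Theorem 2 (§3.2, pp. 8–9)] -/
theorem knThm2_refined_eform (w : Sym2 (Fin n) → unitInterval) (o b a₁ a₂ a₃ : Fin n) (t : ℝ)
    (h12 : a₁ ≠ a₂) (h13 : a₁ ≠ a₃) (h23 : a₂ ≠ a₃) (ho1 : o ≠ a₁) (ho2 : o ≠ a₂) (ho3 : o ≠ a₃)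
    (hP₁₂ : 0 < (prodBernoulli w).real
      ((openConn a₁ a₃)ᶜ ∩ (openConn a₂ a₃)ᶜ ∩ (openConn o a₃)ᶜ : Set (BondConfig (Fin n))))
    (hP₁ : 0 < (prodBernoulli w).real
      ((openConn a₁ a₂)ᶜ ∩ (openConn a₁ a₃)ᶜ ∩ ((openConn o a₂)ᶜ ∩ (openConn o a₃)ᶜ) : Set (BondConfig (Fin n))))
    (hP₂ : 0 < (prodBernoulli w).real
      ((openConn a₂ a₁)ᶜ ∩ (openConn a₂ a₃)ᶜ ∩ ((openConn o a₁)ᶜ ∩ (openConn o a₃)ᶜ) : Set (BondConfig (Fin n))))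
    (hcert : 0 ≤
        (prodBernoulli w).real ((openConn a₁ a₂)ᶜ ∩ (openConn a₁ a₃)ᶜ ∩ ((openConn o a₂)ᶜ ∩ (openConn o a₃)ᶜ) : Set (BondConfig (Fin n)))
          * (prodBernoulli w).real ((openConn a₂ a₁)ᶜ ∩ (openConn a₂ a₃)ᶜ ∩ ((openConn o a₁)ᶜ ∩ (openConn o a₃)ᶜ) : Set (BondConfig (Fin n)))
          * ((prodBernoulli w).real ((openConn a₁ a₃)ᶜ ∩ (openConn a₂ a₃)ᶜ ∩ (openConn o a₃)ᶜ ∩ (openConn a₁ o ∪ openConn a₂ o))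
            * ((prodBernoulli w).real ((openConn a₁ a₃)ᶜ ∩ (openConn a₂ a₃)ᶜ ∩ (openConn o a₃)ᶜ ∩ (openConn a₁ b ∩ openConn a₂ b))
              - (prodBernoulli w).real ((openConn a₁ a₃)ᶜ ∩ (openConn a₂ a₃)ᶜ ∩ (openConn o a₃)ᶜ ∩ openConn a₃ b)))
      + (prodBernoulli w).real ((openConn a₂ a₁)ᶜ ∩ (openConn a₂ a₃)ᶜ ∩ ((openConn o a₁)ᶜ ∩ (openConn o a₃)ᶜ) : Set (BondConfig (Fin n)))
          * (prodBernoulli w).real ((openConn a₁ a₃)ᶜ ∩ (openConn a₂ a₃)ᶜ ∩ (openConn o a₃)ᶜ : Set (BondConfig (Fin n)))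
          * ((prodBernoulli w).real ((openConn a₁ a₂)ᶜ ∩ (openConn a₁ a₃)ᶜ ∩ ((openConn o a₂)ᶜ ∩ (openConn o a₃)ᶜ) ∩ openConn a₁ o)
            * ((prodBernoulli w).real ((openConn a₁ a₂)ᶜ ∩ (openConn a₁ a₃)ᶜ ∩ ((openConn o a₂)ᶜ ∩ (openConn o a₃)ᶜ) ∩ openConn a₁ b)
              - (prodBernoulli w).real ((openConn a₁ a₂)ᶜ ∩ (openConn a₁ a₃)ᶜ ∩ ((openConn o a₂)ᶜ ∩ (openConn o a₃)ᶜ) ∩ (openConn a₂ b ∩ openConn a₃ b))))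
      + (prodBernoulli w).real ((openConn a₁ a₂)ᶜ ∩ (openConn a₁ a₃)ᶜ ∩ ((openConn o a₂)ᶜ ∩ (openConn o a₃)ᶜ) : Set (BondConfig (Fin n)))
          * (prodBernoulli w).real ((openConn a₁ a₃)ᶜ ∩ (openConn a₂ a₃)ᶜ ∩ (openConn o a₃)ᶜ : Set (BondConfig (Fin n)))
          * ((prodBernoulli w).real ((openConn a₂ a₁)ᶜ ∩ (openConn a₂ a₃)ᶜ ∩ ((openConn o a₁)ᶜ ∩ (openConn o a₃)ᶜ) ∩ openConn a₂ o)
            * ((prodBernoulli w).real ((openConn a₂ a₁)ᶜ ∩ (openConn a₂ a₃)ᶜ ∩ ((openConn o a₁)ᶜ ∩ (openConn o a₃)ᶜ) ∩ openConn a₂ b)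
              - (prodBernoulli w).real ((openConn a₂ a₁)ᶜ ∩ (openConn a₂ a₃)ᶜ ∩ ((openConn o a₁)ᶜ ∩ (openConn o a₃)ᶜ) ∩ (openConn a₁ b ∩ openConn a₃ b)))))
    (hτ3 : 1 - t ≤ (prodBernoulli w).real (openConn a₃ b)) :
    (prodBernoulli w).real ((openConn o a₁ ∪ openConn o a₂ ∪ openConn o a₃) \ openConn o b) ≤ t := by
  have hX := knThm2_refined' w o b a₁ a₂ a₃ h12 h13 h23 ho1 ho2 ho3 hP₁₂ hP₁ hP₂ hcert
  have hm : ∀ s : Set (BondConfig (Fin n)), MeasurableSet s := fun _ => MeasurableSet.of_discrete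
  have h1 := measureReal_inter_add_sdiff (μ := prodBernoulli w)
    (s := openConn o a₁ ∪ openConn o a₂ ∪ openConn o a₃) (hm (openConn o b))
  have h2 := measureReal_inter_add_sdiff (μ := prodBernoulli w)
    (s := openConn o a₁ ∪ openConn o a₂ ∪ openConn o a₃) (hm (openConn a₃ b))
  have h3 : (prodBernoulli w).real
      ((openConn o a₁ ∪ openConn o a₂ ∪ openConn o a₃) \ openConn a₃ b) ≤
      (prodBernoulli w).real ((openConn a₃ b)ᶜ : Set (BondConfig (Fin n))) :=
    measureReal_mono fun ω hω => hω.2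
  have h4 : (prodBernoulli w).real ((openConn a₃ b)ᶜ : Set (BondConfig (Fin n))) =
      1 - (prodBernoulli w).real (openConn a₃ b : Set (BondConfig (Fin n))) :=
    probReal_compl_eq_one_sub (hm _)
  linarith

end

end Summit.CriticalPhenomena.PercolationContinuityZ3.Theorems
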